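import Summits.Parity.GeneralizedHardyLittlewood.Theorems.LeeYangFibresCellParityLawModelPrimeSumAux
import Summits.Parity.GeneralizedHardyLittlewood.Theorems.LeeYangFibresCellParityLawPrimeUpperBound
import HarnessLib

/-!
# Route `LeeYangFibres`, crux `CellParityLaw` (stmt-Parity-14109), line `section-annihilator`:
# tools for the registered stub `stub_modelPrimeSum`, part 2 — the integer-sum estimate

Skeleton v18 (lead c5). With `V(v) = 𝒜.densityProduct (primesProdBelow v) = ∏_{q<v}(1 − g q)`,
`u_n = log(x/n)/log n` and the Buchstab weight `Φ(n) = I_m(u_n)/u_n`: the telescoping step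
`V(n) − V(n+1) = [n prime] g(n) V(n)` (`densityProduct_natCast_sub_succ`), `0 ≤ V ≤ 1`; the two-sided Mertens
evaluation `|V(n) − V(z) log z/log n| ≤ 2 (L'/log z) V(z)` for integers `z ≤ n ≤ x` (`abs_densityProduct_sub_le`:
`Ω(1, L')` from above, the admissibility clause from below); the Abel-summation error against that model
(`abel_error`); and the integer-sum estimate (`integer_sum_estimate`)
`|Σ_{⌊z⌋<n≤⌊x^{1/2}⌋} (V(n) − V(n+1)) Φ(n) − V(z)(lz/lx) I_{m+1}(lx/lz)| ≤ B(4L'+2) V(z)/lz` for `lx ≤ B lz`, the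
Riemann sum being `∫_1^{u'−1} I_m(t) dt/t = I_{m+1}(u')` (`roughCellDensity_succ`).

References: E. Bombieri, Rend. Accad. Naz. XL (5) 1/2 (1975/76) §1 [BombieriAsymptoticSieve1976];
H. Iwaniec, Acta Arith. 36 (1980) (1.2) [IwaniecActaArith1980].
-/

noncomputable section

open scoped BigOperators Classical
open Finset Literature.NumberTheory.Sieve

namespace Summit.Parity.GeneralizedHardyLittlewood.Cruxes.CellParityLaw.SectionAnnihilator

namespace ModelPrimeSumAux

/-! ## The density product at integers and the two-sided Mertens evaluation -/

/-- `V(n) = ∏_{q < n, q prime} (1 − g(q))` at a natural number `n`. [folklore] -/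
theorem densityProduct_natCast (𝒜 : SieveSequence) (n : ℕ) :
    𝒜.densityProduct (primesProdBelow (n : ℝ)) = ∏ q ∈ Nat.primesBelow n, (1 - 𝒜.density q) := by
  unfold SieveSequence.densityProduct
  rw [primeFactors_primesProdBelow, Nat.ceil_natCast]

/-- **Telescoping step** `V(n) − V(n+1) = [n prime] · g(n) V(n)`: passing from the primes `< n` to the primes
`< n + 1` adds the factor `1 − g(n)` exactly when `n` is prime (`Nat.primesBelow_succ`). [folklore] -/
theorem densityProduct_natCast_sub_succ (𝒜 : SieveSequence) (n : ℕ) :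
    𝒜.densityProduct (primesProdBelow (n : ℝ)) - 𝒜.densityProduct (primesProdBelow ((n + 1 : ℕ) : ℝ)) =
      if n.Prime then 𝒜.density n * 𝒜.densityProduct (primesProdBelow (n : ℝ)) else 0 := by
  rw [densityProduct_natCast, densityProduct_natCast, Nat.primesBelow_succ]
  split_ifs with hp
  · rw [Finset.prod_insert (Nat.notMem_primesBelow n)]
    ring
  · simp

/-- `0 ≤ V(P) ≤ 1` when `0 ≤ g(p) < 1` at every prime. [folklore] -/
theorem densityProduct_mem_Icc (𝒜 : SieveSequence)
    (hg : ∀ p : ℕ, p.Prime → 0 ≤ 𝒜.density p ∧ 𝒜.density p < 1) (P : ℕ) :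
    0 ≤ 𝒜.densityProduct P ∧ 𝒜.densityProduct P ≤ 1 := by
  unfold SieveSequence.densityProduct
  refine ⟨Finset.prod_nonneg fun p hp => ?_, Finset.prod_le_one (fun p hp => ?_) fun p hp => ?_⟩
  · exact sub_nonneg.mpr (hg p (Nat.prime_of_mem_primeFactors hp)).2.le
  · exact sub_nonneg.mpr (hg p (Nat.prime_of_mem_primeFactors hp)).2.le
  · linarith [(hg p (Nat.prime_of_mem_primeFactors hp)).1]

/-- Scalar step of the two-sided Mertens evaluation: if `1/(r(1+α)) ≤ Q ≤ 1/(r(1−α))` with `r ≥ 1`,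
`0 ≤ α ≤ 1/2`, then `|Q − 1/r| ≤ 2α`. [folklore] -/
theorem abs_sub_inv_le_of_two_sided {Q r α : ℝ} (hr : 1 ≤ r) (hα0 : 0 ≤ α) (hα : α ≤ 1 / 2)
    (hlo : 1 / (r * (1 + α)) ≤ Q) (hhi : Q ≤ 1 / (r * (1 - α))) : |Q - 1 / r| ≤ 2 * α := by
  have hr0 : 0 < r := by linarith
  have h1 : 0 < 1 - α := by linarith
  have h2 : 0 < 1 + α := by linarith
  have hup : 1 / (r * (1 - α)) - 1 / r ≤ 2 * α := by
    rw [div_sub_div _ _ (mul_pos hr0 h1).ne' hr0.ne', div_le_iff₀ (mul_pos (mul_pos hr0 h1) hr0)]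
    have : 0 ≤ r * α * (2 * r * (1 - α) - 1) :=
      mul_nonneg (mul_nonneg hr0.le hα0) (by nlinarith)
    nlinarith
  have hdn : 1 / r - 1 / (r * (1 + α)) ≤ 2 * α := by
    rw [div_sub_div _ _ hr0.ne' (mul_pos hr0 h2).ne', div_le_iff₀ (mul_pos hr0 (mul_pos hr0 h2))]
    have : 0 ≤ r * α * (2 * r * (1 + α) - 1) :=
      mul_nonneg (mul_nonneg hr0.le hα0) (by nlinarith)
    nlinarith
  rw [abs_le]
  constructor <;> linarith

open PrimeUpperBoundAux in
/-- **Two-sided Mertens evaluation of the density product.** Under `Ω(1, L')` (upper bound for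
`∏_{z ≤ q < n}(1 − g q)⁻¹`) and the admissibility clause (lower bound, `w₀ ≤ z ≤ n ≤ x`), with
`log z ≥ 2L'`: `|V(n) − V(z) · log z/log n| ≤ 2 (L'/log z) V(z)` for integers `n ≥ z`. [folklore] -/
theorem abs_densityProduct_sub_le (𝒜 : SieveSequence) {L' x z w₀ : ℝ}
    (hdim : HasIwaniecDimension 𝒜.density 1 L')
    (hMert : ∀ w z' : ℝ, w₀ ≤ w → w ≤ z' → z' ≤ x →
      Real.log z' / Real.log w * (1 - L' / Real.log w) ≤
        ∏ p ∈ (Nat.primesBelow ⌈z'⌉₊).filter (fun p : ℕ => w ≤ (p : ℝ)), (1 - 𝒜.density p)⁻¹)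
    (hw₀ : w₀ ≤ z) (hz2 : 2 ≤ z) (hL : 2 * L' ≤ Real.log z) {n : ℕ} (hzn : z ≤ n) (hnx : (n : ℝ) ≤ x) :
    |𝒜.densityProduct (primesProdBelow (n : ℝ)) -
        𝒜.densityProduct (primesProdBelow z) * (Real.log z / Real.log n)| ≤
      2 * (L' / Real.log z) * 𝒜.densityProduct (primesProdBelow z) := by
  have hL0 : 0 ≤ L' := hdim.nonneg
  have hlz0 : 0 < Real.log z := Real.log_pos (by linarith)
  have hlzn : Real.log z ≤ Real.log n := Real.log_le_log (by linarith) hzn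
  have hln0 : 0 < Real.log (n : ℝ) := by linarith
  set V : ℝ := 𝒜.densityProduct (primesProdBelow z) with hV
  set Q : ℝ := ∏ p ∈ (Nat.primesBelow ⌈(n : ℝ)⌉₊).filter (fun p : ℕ => z ≤ (p : ℝ)),
    (1 - 𝒜.density p) with hQ
  have hsplit : 𝒜.densityProduct (primesProdBelow (n : ℝ)) = Q * V := densityProduct_split 𝒜 hzn
  have hQpos : 0 < Q := Finset.prod_pos fun p hp =>
    sub_pos.mpr (hdim.1 p (Nat.prime_of_mem_primesBelow (Finset.mem_filter.mp hp).1)).2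
  have hV0 : 0 ≤ V := (densityProduct_mem_Icc 𝒜 hdim.1 _).1
  have hup := hdim.2 z n hz2 hzn
  have hlo := hMert z n hw₀ hzn hnx
  rw [Finset.prod_inv_distrib, ← hQ, Real.rpow_one] at hup
  rw [Finset.prod_inv_distrib, ← hQ] at hlo
  set r : ℝ := Real.log n / Real.log z with hr
  set α : ℝ := L' / Real.log z with hα
  have hr1 : 1 ≤ r := by rwa [hr, one_le_div hlz0]
  have hr0 : 0 < r := by linarith
  have hα0 : 0 ≤ α := div_nonneg hL0 hlz0.le
  have hα2 : α ≤ 1 / 2 := by rw [hα, div_le_iff₀ hlz0]; linarith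
  have hQlo : 1 / (r * (1 + α)) ≤ Q := by
    rw [one_div]
    exact inv_le_of_inv_le₀ hQpos hup
  have hQhi : Q ≤ 1 / (r * (1 - α)) := by
    rw [one_div]
    exact le_inv_of_le_inv₀ (mul_pos hr0 (by linarith)) hlo
  have habs := abs_sub_inv_le_of_two_sided hr1 hα0 hα2 hQlo hQhi
  have e : Real.log z / Real.log n = 1 / r := by rw [hr, one_div_div]
  rw [hsplit, e, show Q * V - V * (1 / r) = V * (Q - 1 / r) by ring, abs_mul, abs_of_nonneg hV0,
    show 2 * α * V = V * (2 * α) by ring]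
  exact mul_le_mul_of_nonneg_left habs hV0

/-! ## Abel summation against the Mertens model; the integer-sum estimate -/

/-- **Abel-summation error.** For sequences `W` (the density product at integers) and `Vt` (its Mertens
model) with `|W n − Vt n| ≤ BU` on `a+1, …, b+1`, and the weight `Φ n = I_m(t n)/t n` along a nonincreasing
`t` with `I_m(t n) ≤ Bf`: `|Σ (W n − W(n+1)) Φ n − Σ (Vt n − Vt(n+1)) Φ n| ≤ BU (2 + 2 Bf)` (Abel summation of
`U = W − Vt` against `Φ`, whose variation is `≤ 2 Bf` as a product of the nonincreasing `I_m(t n) ∈ [0, Bf]`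
and the nondecreasing `(max (t n) 1)⁻¹ ∈ [0, 1]`). [folklore] -/
theorem abel_error {m : ℕ} (hm : 1 ≤ m) (W Vt t : ℕ → ℝ) {a b : ℕ} (hab : a ≤ b) {BU Bf : ℝ}
    (hU : ∀ n, a + 1 ≤ n → n ≤ b + 1 → |W n - Vt n| ≤ BU)
    (hmono : ∀ n, a + 1 ≤ n → n ≤ b → t (n + 1) ≤ t n)
    (hf : ∀ n, a + 1 ≤ n → n ≤ b + 1 → roughCellDensity m (t n) ≤ Bf) :
    |∑ n ∈ Ioc a b, (W n - W (n + 1)) * (roughCellDensity m (t n) / t n) -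
        ∑ n ∈ Ioc a b, (Vt n - Vt (n + 1)) * (roughCellDensity m (t n) / t n)| ≤
      BU * (2 + 2 * Bf) := by
  set Φ : ℕ → ℝ := fun n => roughCellDensity m (t n) / t n with hΦ
  set U : ℕ → ℝ := fun n => W n - Vt n with hU'
  have hBU : 0 ≤ BU := (abs_nonneg _).trans (hU (a + 1) le_rfl (by omega))
  have hΦ01 : ∀ n, 0 ≤ Φ n ∧ Φ n ≤ 1 := fun n => weight_mem_Icc hm (t n)
  have e1 : ∑ n ∈ Ioc a b, (W n - W (n + 1)) * Φ n - ∑ n ∈ Ioc a b, (Vt n - Vt (n + 1)) * Φ n =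
      ∑ n ∈ Ioc a b, (U n - U (n + 1)) * Φ n := by
    rw [← Finset.sum_sub_distrib]
    refine Finset.sum_congr rfl fun n _ => ?_
    simp only [hU']
    ring
  -- bounded variation of `Φ`
  have hBV : ∑ n ∈ Ioc a b, |Φ (n + 1) - Φ n| ≤ 2 * Bf := by
    have e2 : ∀ n, Φ n = roughCellDensity m (t n) * (max (t n) 1)⁻¹ := fun n =>
      weight_eq_mul_inv_max m (t n)
    simp only [e2]
    refine sum_abs_sub_mul_le (fun n => roughCellDensity m (t n)) (fun n => (max (t n) 1)⁻¹) hab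
      ?_ ?_ ?_ ?_
    · intro n h1 h2
      exact monotone_roughCellDensity m (hmono n h1 h2)
    · intro n h1 h2
      have hlo : (0 : ℝ) < max (t (n + 1)) 1 := lt_of_lt_of_le one_pos (le_max_right _ _)
      have hlo' : (0 : ℝ) < max (t n) 1 := lt_of_lt_of_le one_pos (le_max_right _ _)
      exact (inv_le_inv₀ hlo' hlo).mpr (max_le_max (hmono n h1 h2) le_rfl)
    · intro n h1 h2
      exact ⟨roughCellDensity_nonneg _ _, hf n h1 h2⟩
    · intro n _ _
      exact ⟨inv_nonneg.mpr (le_trans zero_le_one (le_max_right _ _)),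
        inv_le_one_of_one_le₀ (le_max_right _ _)⟩
  show |∑ n ∈ Ioc a b, (W n - W (n + 1)) * Φ n - ∑ n ∈ Ioc a b, (Vt n - Vt (n + 1)) * Φ n| ≤
    BU * (2 + 2 * Bf)
  rw [e1, sum_Ioc_abel U Φ hab]
  have hT1 : |U (a + 1) * Φ (a + 1)| ≤ BU := by
    rw [abs_mul, abs_of_nonneg (hΦ01 _).1]
    calc |U (a + 1)| * Φ (a + 1) ≤ BU * 1 :=
          mul_le_mul (hU _ le_rfl (by omega)) (hΦ01 _).2 (hΦ01 _).1 hBU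
      _ = BU := mul_one _
  have hT2 : |U (b + 1) * Φ (b + 1)| ≤ BU := by
    rw [abs_mul, abs_of_nonneg (hΦ01 _).1]
    calc |U (b + 1)| * Φ (b + 1) ≤ BU * 1 :=
          mul_le_mul (hU _ (by omega) le_rfl) (hΦ01 _).2 (hΦ01 _).1 hBU
      _ = BU := mul_one _
  have hT3 : |∑ n ∈ Ioc a b, U (n + 1) * (Φ (n + 1) - Φ n)| ≤ BU * (2 * Bf) := by
    calc |∑ n ∈ Ioc a b, U (n + 1) * (Φ (n + 1) - Φ n)|
        ≤ ∑ n ∈ Ioc a b, |U (n + 1) * (Φ (n + 1) - Φ n)| := Finset.abs_sum_le_sum_abs _ _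
      _ ≤ ∑ n ∈ Ioc a b, BU * |Φ (n + 1) - Φ n| := Finset.sum_le_sum fun n hn => by
          rw [Finset.mem_Ioc] at hn
          rw [abs_mul]
          exact mul_le_mul_of_nonneg_right (hU (n + 1) (by omega) (by omega)) (abs_nonneg _)
      _ = BU * ∑ n ∈ Ioc a b, |Φ (n + 1) - Φ n| := by rw [Finset.mul_sum]
      _ ≤ BU * (2 * Bf) := mul_le_mul_of_nonneg_left hBV hBU
  obtain ⟨h1l, h1r⟩ := abs_le.mp hT1
  obtain ⟨h2l, h2r⟩ := abs_le.mp hT2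
  obtain ⟨h3l, h3r⟩ := abs_le.mp hT3
  rw [abs_le]
  constructor <;> nlinarith

/-- **The integer-sum estimate** (telescoped main term versus the model). With `V(v) = ∏_{q<v}(1 − g q)`,
`u_n = log(x/n)/log n`, `Φ(n) = I_m(u_n)/u_n`, `lx = log x`, `lz = log z`, for `2 ≤ z ≤ x^{1/2}`, `lx ≤ B lz`,
two-sided Mertens above `w₀ ≤ z` and `lz ≥ 2L'`:
`|Σ_{⌊z⌋ < n ≤ ⌊x^{1/2}⌋} (V(n) − V(n+1)) Φ(n) − V(z) (lz/lx) I_{m+1}(lx/lz)| ≤ B (4L' + 2) V(z)/lz`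
(Abel summation against the Mertens model `V(z) lz/log n`, `abel_error`, plus the Riemann sum of the weight
over the partition `u_n` of `[1, lx/lz − 1]` of mesh `≤ lx/(z lz²)`, `riemann_error`, `roughCellDensity_succ`).
[folklore] -/
theorem integer_sum_estimate (𝒜 : SieveSequence) {L' x z w₀ lx lz B : ℝ} {m : ℕ} (hm : 1 ≤ m)
    (hdim : HasIwaniecDimension 𝒜.density 1 L')
    (hMert : ∀ w z' : ℝ, w₀ ≤ w → w ≤ z' → z' ≤ x →
      Real.log z' / Real.log w * (1 - L' / Real.log w) ≤
        ∏ p ∈ (Nat.primesBelow ⌈z'⌉₊).filter (fun p : ℕ => w ≤ (p : ℝ)), (1 - 𝒜.density p)⁻¹)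
    (hw₀z : w₀ ≤ z) (hz2 : 2 ≤ z) (hzxh : z ≤ x ^ (1 / 2 : ℝ)) (hx1 : 1 < x)
    (hlx : lx = Real.log x) (hlz : lz = Real.log z) (hL2 : 2 * L' ≤ lz) (hB : lx ≤ B * lz) :
    |∑ n ∈ Ioc ⌊z⌋₊ ⌊x ^ (1 / 2 : ℝ)⌋₊,
        (𝒜.densityProduct (primesProdBelow (n : ℝ)) -
            𝒜.densityProduct (primesProdBelow ((n + 1 : ℕ) : ℝ))) *
          (roughCellDensity m (Real.log (x / n) / Real.log n) / (Real.log (x / n) / Real.log n)) -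
      𝒜.densityProduct (primesProdBelow z) * (lz / lx) * roughCellDensity (m + 1) (lx / lz)| ≤
      B * (4 * L' + 2) * 𝒜.densityProduct (primesProdBelow z) / lz := by
  have hL'0 : 0 ≤ L' := hdim.nonneg
  have hx0 : 0 < x := by linarith
  have hz0 : 0 < z := by linarith
  have hlz0 : 0 < lz := by rw [hlz]; exact Real.log_pos (by linarith)
  set xh : ℝ := x ^ (1 / 2 : ℝ) with hxh
  have hxhpos : 0 < xh := Real.rpow_pos_of_pos hx0 _
  have hlxh : Real.log xh = lx / 2 := by rw [hxh, Real.log_rpow hx0, hlx]; ring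
  have hlzhi : lz ≤ lx / 2 := by rw [← hlxh, hlz]; exact Real.log_le_log hz0 hzxh
  have hlx0 : 0 < lx := by linarith
  have hxh2 : 2 ≤ xh := hz2.trans hzxh
  have hxhsq : xh * xh = x := by rw [hxh, ← Real.sqrt_eq_rpow, Real.mul_self_sqrt hx0.le]
  have hxh1x : xh + 1 ≤ x := by nlinarith
  have hBu : lx / lz ≤ B := by rwa [div_le_iff₀ hlz0]
  have hB0 : 0 < B := lt_of_lt_of_le (div_pos hlx0 hlz0) hBu
  set V : ℝ := 𝒜.densityProduct (primesProdBelow z) with hV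
  have hV0 : 0 ≤ V := (densityProduct_mem_Icc 𝒜 hdim.1 _).1
  set a : ℕ := ⌊z⌋₊ with ha
  set b : ℕ := ⌊xh⌋₊ with hb
  have hab : a ≤ b := Nat.floor_mono hzxh
  set W : ℕ → ℝ := fun n => 𝒜.densityProduct (primesProdBelow (n : ℝ)) with hW
  set t : ℕ → ℝ := fun n => Real.log (x / n) / Real.log n with ht
  set ρ : ℝ := lz / lx with hρ
  have hρ0 : 0 < ρ := div_pos hlz0 hlx0
  set δ : ℝ := lx / (z * lz ^ 2) with hδ
  have hδ0 : 0 ≤ δ := by positivity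
  set T : ℝ := lx / lz - 1 with hT
  have hT1 : 1 ≤ T := by rw [hT, le_sub_iff_add_le, le_div_iff₀ hlz0]; linarith
  set Vt : ℕ → ℝ := fun n => V * ρ * (t n + 1) with hVt
  have hzlt : ∀ n : ℕ, a + 1 ≤ n → z < n := fun n hn => by
    have h1 : z < (a : ℝ) + 1 := Nat.lt_floor_add_one z
    have h2 : ((a + 1 : ℕ) : ℝ) ≤ n := by exact_mod_cast hn
    push_cast at h2
    linarith
  have hlex : ∀ n : ℕ, n ≤ b + 1 → (n : ℝ) ≤ xh + 1 := fun n hn => by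
    have h1 : (b : ℝ) ≤ xh := Nat.floor_le hxhpos.le
    have h2 : (n : ℝ) ≤ ((b + 1 : ℕ) : ℝ) := by exact_mod_cast hn
    push_cast at h2
    linarith
  have htn : ∀ n : ℕ, a + 1 ≤ n → t n = lx / Real.log n - 1 ∧ lz < Real.log n := fun n hn => by
    have hzn := hzlt n hn
    have hn0 : (0 : ℝ) < n := hz0.trans hzn
    have hln : lz < Real.log n := by rw [hlz]; exact Real.log_lt_log hz0 hzn
    refine ⟨?_, hln⟩
    show Real.log (x / n) / Real.log n = lx / Real.log n - 1
    have hln0 : Real.log (n : ℝ) ≠ 0 := ne_of_gt (by linarith)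
    rw [Real.log_div hx0.ne' hn0.ne', ← hlx, div_sub_one hln0]
  have hstep : ∀ n : ℕ, a + 1 ≤ n → t (n + 1) ≤ t n ∧ t n - t (n + 1) ≤ δ := fun n hn => by
    obtain ⟨e1, -⟩ := htn n hn
    obtain ⟨e2, -⟩ := htn (n + 1) (by omega)
    have h := div_log_sub_div_log_mem (w := ((n + 1 : ℕ) : ℝ)) hlx0.le hz2 (hzlt n hn).le
      (by push_cast; linarith) (by push_cast; linarith)
    rw [← hlz] at h
    rw [e1, e2]
    constructor <;> linarith [h.1, h.2]
  have hmono : ∀ n, a + 1 ≤ n → n ≤ b → t (n + 1) ≤ t n := fun n h1 _ => (hstep n h1).1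
  have hone : ∀ n, a + 1 ≤ n → n ≤ b → 1 ≤ t n := fun n h1 h2 => by
    obtain ⟨e, hln⟩ := htn n h1
    have hnb : (n : ℝ) ≤ b := by exact_mod_cast h2
    have hnxh : (n : ℝ) ≤ xh := hnb.trans (Nat.floor_le hxhpos.le)
    have hln2 : Real.log n ≤ lx / 2 := by
      rw [← hlxh]
      exact Real.log_le_log (hz0.trans (hzlt n h1)) hnxh
    rw [e, le_sub_iff_add_le, le_div_iff₀ (by linarith)]
    linarith
  have htop : t (a + 1) ≤ T := by
    obtain ⟨e, hln⟩ := htn (a + 1) le_rfl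
    rw [e, hT]
    exact sub_le_sub_right (div_le_div_of_nonneg_left hlx0.le hlz0 hln.le) _
  have htop' : T - t (a + 1) ≤ δ := by
    obtain ⟨e, -⟩ := htn (a + 1) le_rfl
    have ha1 : ((a + 1 : ℕ) : ℝ) ≤ z + 1 := by
      push_cast
      linarith [Nat.floor_le hz0.le]
    have h := div_log_sub_div_log_mem (w := ((a + 1 : ℕ) : ℝ)) hlx0.le hz2 le_rfl
      (hzlt (a + 1) le_rfl).le ha1
    rw [← hlz] at h
    rw [e, hT]
    linarith [h.2]
  have hbxh : xh < ((b + 1 : ℕ) : ℝ) := by push_cast; exact Nat.lt_floor_add_one xh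
  have hbot : t (b + 1) ≤ 1 := by
    obtain ⟨e, hln⟩ := htn (b + 1) (by omega)
    have hl : lx / 2 < Real.log ((b + 1 : ℕ) : ℝ) := by
      rw [← hlxh]
      exact Real.log_lt_log hxhpos hbxh
    rw [e, sub_le_iff_le_add, div_le_iff₀ (by linarith)]
    linarith
  have hbot' : 1 - t (b + 1) ≤ δ := by
    obtain ⟨e, -⟩ := htn (b + 1) (by omega)
    have h := div_log_sub_div_log_mem (w := ((b + 1 : ℕ) : ℝ)) hlx0.le hz2 hzxh hbxh.le
      (hlex (b + 1) le_rfl)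
    rw [hlxh, ← hlz] at h
    have e2 : lx / (lx / 2) = 2 := by field_simp
    rw [e2] at h
    rw [e]
    linarith [h.2]
  have hbot0 : 0 ≤ t (b + 1) := by
    obtain ⟨e, hln⟩ := htn (b + 1) (by omega)
    have hl : Real.log ((b + 1 : ℕ) : ℝ) ≤ lx := by
      rw [hlx]
      exact Real.log_le_log (hz0.trans (hzlt (b + 1) (by omega)))
        ((hlex (b + 1) le_rfl).trans hxh1x)
    rw [e, sub_nonneg, le_div_iff₀ (by linarith)]
    linarith
  have hf : ∀ n, a + 1 ≤ n → n ≤ b + 1 → roughCellDensity m (t n) ≤ B - 1 := fun n h1 _ => by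
    rcases lt_or_ge (t n) 1 with hlt | hge
    · rw [roughCellDensity_of_lt_one m hlt]
      linarith
    · refine (roughCellDensity_le hm hge).trans ?_
      obtain ⟨e, hln⟩ := htn n h1
      rw [e]
      have : lx / Real.log n ≤ lx / lz := div_le_div_of_nonneg_left hlx0.le hlz0 hln.le
      linarith
  have hU : ∀ n, a + 1 ≤ n → n ≤ b + 1 → |W n - Vt n| ≤ 2 * (L' / lz) * V := fun n h1 h2 => by
    obtain ⟨e, hln⟩ := htn n h1
    have hnx : (n : ℝ) ≤ x := (hlex n h2).trans hxh1x
    have hL2' : 2 * L' ≤ Real.log z := by rwa [← hlz]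
    have h := abs_densityProduct_sub_le 𝒜 hdim hMert hw₀z hz2 hL2' (hzlt n h1).le hnx
    rw [← hV, ← hlz] at h
    have hln0 : Real.log (n : ℝ) ≠ 0 := ne_of_gt (by linarith)
    have e2 : Vt n = V * (lz / Real.log n) := by
      show V * ρ * (t n + 1) = V * (lz / Real.log n)
      rw [e, hρ, sub_add_cancel]
      field_simp
    rw [e2]
    exact h
  have habel := abel_error hm W Vt t hab hU hmono hf
  have hriem := riemann_error hm t hab hT1 hmono (fun n h1 _ => (hstep n h1).2) hone htop htop' hbot hbot'
  have hI : roughCellDensity (m + 1) (lx / lz) = ∫ s in (1 : ℝ)..T, roughCellDensity m s / s := by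
    rw [hT]
    exact roughCellDensity_succ hm _
  have hM : ∑ n ∈ Ioc a b, (Vt n - Vt (n + 1)) * (roughCellDensity m (t n) / t n) =
      V * ρ * ∑ n ∈ Ioc a b, roughCellDensity m (t n) / t n * (t n - t (n + 1)) := by
    rw [Finset.mul_sum]
    refine Finset.sum_congr rfl fun n _ => ?_
    simp only [hVt]
    ring
  have hmid : |∑ n ∈ Ioc a b, (Vt n - Vt (n + 1)) * (roughCellDensity m (t n) / t n) -
      V * ρ * roughCellDensity (m + 1) (lx / lz)| ≤ V * ρ * (2 * δ * (T - t (b + 1)) + 2 * δ) := by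
    rw [hM, hI, ← mul_sub, abs_mul, abs_of_nonneg (mul_nonneg hV0 hρ0.le)]
    exact mul_le_mul_of_nonneg_left hriem (mul_nonneg hV0 hρ0.le)
  have hnum : 2 * (L' / lz) * V * (2 + 2 * (B - 1)) + V * ρ * (2 * δ * (T - t (b + 1)) + 2 * δ) ≤
      B * (4 * L' + 2) * V / lz := by
    have hρT : ρ * (T + 1) = 1 := by
      rw [hρ, hT]
      field_simp
      ring
    have hδle : δ ≤ B / lz := by
      rw [hδ, div_le_div_iff₀ (by positivity) hlz0]
      calc lx * lz ≤ B * lz * lz := mul_le_mul_of_nonneg_right hB hlz0.le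
        _ ≤ B * lz * lz * z :=
            le_mul_of_one_le_right (mul_nonneg (mul_nonneg hB0.le hlz0.le) hlz0.le) (by linarith)
        _ = B * (z * lz ^ 2) := by ring
    have h1 : V * ρ * (2 * δ * (T - t (b + 1)) + 2 * δ) ≤ V * ρ * (2 * δ * T + 2 * δ) := by
      refine mul_le_mul_of_nonneg_left ?_ (mul_nonneg hV0 hρ0.le)
      linarith [mul_nonneg hδ0 hbot0]
    have h2 : V * ρ * (2 * δ * T + 2 * δ) = 2 * V * δ := by
      calc V * ρ * (2 * δ * T + 2 * δ) = 2 * V * δ * (ρ * (T + 1)) := by ring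
        _ = 2 * V * δ := by rw [hρT, mul_one]
    have h3 : 2 * V * δ ≤ 2 * V * (B / lz) := mul_le_mul_of_nonneg_left hδle (by positivity)
    have e4 : 2 * (L' / lz) * V * (2 + 2 * (B - 1)) + 2 * V * (B / lz) =
        B * (4 * L' + 2) * V / lz := by
      field_simp
      ring
    linarith
  have h := abs_sub_le (∑ n ∈ Ioc a b, (W n - W (n + 1)) * (roughCellDensity m (t n) / t n))
    (∑ n ∈ Ioc a b, (Vt n - Vt (n + 1)) * (roughCellDensity m (t n) / t n))
    (V * ρ * roughCellDensity (m + 1) (lx / lz))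
  show |∑ n ∈ Ioc a b, (W n - W (n + 1)) * (roughCellDensity m (t n) / t n) -
      V * ρ * roughCellDensity (m + 1) (lx / lz)| ≤ B * (4 * L' + 2) * V / lz
  linarith

end ModelPrimeSumAux

/-- **`stub_densityProductTwoSided`** (registered sub-goal of the line, carried by this auxiliary file): the
two-sided Mertens evaluation of the density product at integers `z ≤ n ≤ x`
(`ModelPrimeSumAux.abs_densityProduct_sub_le`). -/
theorem stub_densityProductTwoSided : ∀ (𝒜 : SieveSequence) (L' x z w₀ : ℝ), HasIwaniecDimension 𝒜.density 1 L' → (∀ w z' : ℝ, w₀ ≤ w → w ≤ z' → z' ≤ x → Real.log z' / Real.log w * (1 - L' / Real.log w) ≤ ∏ p ∈ (Nat.primesBelow ⌈z'⌉₊).filter (fun p : ℕ => w ≤ (p : ℝ)), (1 - 𝒜.density p)⁻¹) → w₀ ≤ z → 2 ≤ z → 2 * L' ≤ Real.log z → ∀ n : ℕ, z ≤ n → (n : ℝ) ≤ x → |𝒜.densityProduct (primesProdBelow (n : ℝ)) - 𝒜.densityProduct (primesProdBelow z) * (Real.log z / Real.log n)| ≤ 2 * (L' / Real.log z) * 𝒜.densityProduct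 (primesProdBelow z) :=
  fun 𝒜 _ _ _ _ hdim hMert hw₀ hz2 hL _ hzn hnx =>
    ModelPrimeSumAux.abs_densityProduct_sub_le 𝒜 hdim hMert hw₀ hz2 hL hzn hnx

end Summit.Parity.GeneralizedHardyLittlewood.Cruxes.CellParityLaw.SectionAnnihilator

end
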